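import Literature.Topology.FourManifolds.RelFundamentalClassOfOrientation
import Literature.AlgebraicTopology.SingularHomology.RelFundamentalClassModTwo
import Literature.AlgebraicTopology.SingularHomology.UniversalCoefficientsField
import HarnessLib

/-!
# `b₁(∂B; ℚ) = b₁(B; ℚ)` for a compact oriented 4-manifold with `H₂(B; ℚ) = H₃(B; ℚ) = 0`

Topic `Literature/Topology/FourManifolds`; proof file (theorems only, no definitions, no named
facts), sub-lemma (E-c) of the dictionary fact
`Literature.Topology.FourManifolds.length_eq_bettiNumber_of_isLefschetzHandlebodyOver` (the Betti count of a
rational 1-handlebody `B`, e.g. the upside-down half of a nice splitting of a homotopy 4-sphere).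

A. Hatcher, *Algebraic Topology* (2002), §3.3, Thm. 3.43 (Lefschetz duality, case `A = ∅`:
`Hᵖ(M; R) ≅ Hₙ₋ₚ(M, ∂M; R)` by cap product with the relative fundamental class) with §3.1,
Thm. 3.2 / p. 198 (over a field `Hᵖ ≅ Hom(Hₚ, F)`) and the long exact sequence of the pair
(Thm. 2.13 ff.):

* `BoundaryData.exists_isRelFundamentalClass_of_smoothOrientation` — a smooth orientation of a
  compact smooth `(m+2)`-manifold with boundary `B` (boundary presented by a boundary datum
  `b : BoundaryData (𝓡∂ (m + 2)) B (𝓡 (m + 1))`) gives a relative fundamental class of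
  `(B, ∂B)` over EVERY nontrivial commutative ring `R`: the integral class of the
  null-cobordism `B` of `b.carrier` (`NullCobordism.exists_isRelFundamentalClass_of_smoothOrientation`,
  Hatcher p. 253) orients the external collar (`ExtCollar.orientation`), that `ℤ`-orientation is
  changed to `R` (`HomologicalOrientation.toCoeff`, Hatcher p. 235: `μₓ ↦ μₓ ⊗ 1`), and an
  `R`-orientation of the external collar gives an `R`-fundamental class
  (`ExtCollar.exists_isRelFundamentalClass_of_orientation`);
* `BoundaryData.isZero_relativeSingularHomology_of_isZero_singularHomology` — **Lefschetz
  vanishing over a field**: `Hₚ(B; F) = 0`, `p + q = m + 2` ⟹ `H_q(B, ∂B; F) = 0`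
  (`Hᵖ(B; F) ↪ Hom(Hₚ(B; F), F) = 0`, `kroneckerPairing_injective_of_field`, and
  `⌢ [B, ∂B] : Hᵖ(B; F) → H_q(B, ∂B; F)` onto, `bijective_relCapProduct_of_isRelFundamentalClass_holds`);
* `isIso_singularHomologyMap_subtypeVal_of_isZero` — for any pair `(X, A)`:
  `Hₖ₊₁(X, A) = 0 = Hₖ(X, A)` ⟹ `i_* : Hₖ(A) ≅ Hₖ(X)` (exactness of
  `Hₖ₊₁(X, A) → Hₖ(A) → Hₖ(X) → Hₖ(X, A)`);
* `BoundaryData.finrank_singularHomology_carrier_eq` — general dimension: for `B` compact smooth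
  oriented of dimension `m + 2` with `Hₚ(B; F) = Hₚ'(B; F) = 0`, `p + (k + 1) = m + 2 = p' + k`:
  `dim_F Hₖ(∂B; F) = dim_F Hₖ(B; F)` (the abstract boundary `b.carrier ≃ₜ ∂B` by `b.incl`);
* `finrank_singularHomology_one_boundaryData_eq` — **the case used by fact E**: `B` a compact
  oriented smooth 4-manifold with (nonempty, abstractly presented) boundary and
  `H₂(B; ℚ) = H₃(B; ℚ) = 0`; then `b₁(∂B; ℚ) = b₁(B; ℚ)`
  (`H₂(B, ∂B; ℚ) ≅ H²(B; ℚ) = 0`, `H₁(B, ∂B; ℚ) ≅ H³(B; ℚ) = 0`, so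
  `0 → H₁(∂B; ℚ) → H₁(B; ℚ) → 0` is exact).

## References

* A. Hatcher, *Algebraic Topology*, CUP 2002, §2.1 Thm. 2.13 ff. (exact sequence of the pair),
  §3.1 Thm. 3.2 and p. 198, §3.3 pp. 235, 253 and Thm. 3.43. [HatcherAT2002]
-/

noncomputable section

open CategoryTheory Limits Set Function
open scoped Manifold ContDiff Topology
open Literature.AlgebraicTopology.SingularHomology

namespace Literature.Topology.FourManifolds

/-! ### The exact sequence of a pair with two vanishing relative groups -/

section Pair

variable {X : Type} [TopologicalSpace X]

/-- **`Hₖ₊₁(X, A) = 0 = Hₖ(X, A)` makes `i_* : Hₖ(A; R) → Hₖ(X; R)` an isomorphism** (Hatcher 2002,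
§2.1, Thm. 2.13 ff.: exactness of `Hₖ₊₁(X, A) → Hₖ(A) → Hₖ(X) → Hₖ(X, A)` gives `i_*` mono
(`relativeSingularHomology.exact_δ_map`) and epi (`relativeSingularHomology.exact_map_ofAbsolute`),
and `ModuleCat` is balanced). [cite: HatcherAT2002, §2.1 Thm. 2.13 ff. (long exact sequence of the pair)] -/
theorem isIso_singularHomologyMap_subtypeVal_of_isZero (R : Type) [CommRing R]
    (A : Set X) (k : ℕ) (h₁ : IsZero (relativeSingularHomology R R X A (k + 1)))
    (h₀ : IsZero (relativeSingularHomology R R X A k)) :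
    IsIso (singularHomology.map R R (⟨Subtype.val, continuous_subtype_val⟩ : C(↥A, X)) k) := by
  have hmono : Mono (singularHomology.map R R (⟨Subtype.val, continuous_subtype_val⟩ : C(↥A, X)) k) :=
    (relativeSingularHomology.exact_δ_map R R A k).mono_g (h₁.eq_of_src _ _)
  have hepi : Epi (singularHomology.map R R (⟨Subtype.val, continuous_subtype_val⟩ : C(↥A, X)) k) :=
    (relativeSingularHomology.exact_map_ofAbsolute R R A k).epi_f (h₀.eq_of_tgt _ _)
  exact isIso_of_mono_of_epi _

end Pair

/-! ### Compact smooth oriented manifolds with boundary: fundamental class over any ring,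
Lefschetz vanishing over a field, Betti numbers of the boundary -/

section General

variable {m : ℕ} {B : Type} [TopologicalSpace B] [T2Space B] [SecondCountableTopology B]
  [CompactSpace B] [ChartedSpace (EuclideanHalfSpace (m + 1 + 1)) B] [IsManifold (𝓡∂ (m + 1 + 1)) ∞ B]

/-- **A smooth orientation gives a relative fundamental class over every nontrivial commutative
ring** (Hatcher 2002, §3.3 p. 253: an `R`-orientable compact manifold with boundary has a relative
fundamental class in `Hₙ(M, ∂M; R)`; p. 235: a `ℤ`-orientation induces an `R`-orientation
`μₓ ↦ μₓ ⊗ 1`).  For `B` compact smooth of dimension `m + 2` with boundary presented by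
`b : BoundaryData (𝓡∂ (m + 2)) B (𝓡 (m + 1))` and `o` a smooth orientation: the integral class of
the null-cobordism `B` of `b.carrier` (`NullCobordism.exists_isRelFundamentalClass_of_smoothOrientation`)
orients the external collar over `ℤ` (`ExtCollar.orientation`), hence over `R`
(`HomologicalOrientation.toCoeff`), and that orientation gives the class
(`ExtCollar.exists_isRelFundamentalClass_of_orientation`). [cite: HatcherAT2002, §3.3 p. 253 and p. 235] -/
theorem BoundaryData.exists_isRelFundamentalClass_of_smoothOrientation (R : Type) [CommRing R] [Nontrivial R]
    (b : BoundaryData (𝓡∂ (m + 1 + 1)) B (𝓡 (m + 1))) (o : SmoothOrientation (𝓡∂ (m + 1 + 1)) B) :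
    ∃ z : relativeSingularHomology R R B ((𝓡∂ (m + 1 + 1)).boundary B) (m + 1 + 1),
      IsRelFundamentalClass R ((𝓡∂ (m + 1 + 1)).boundary B) z := by
  haveI : CompactSpace b.carrier := b.compactSpace_carrier
  -- `B` as a null-cobordism of the abstract boundary `b.carrier`
  let c₀ : NullCobordism (m + 1) b.carrier :=
    { W := B
      incl := b.incl
      isSmoothEmbedding_incl := b.isSmoothEmbedding
      range_incl := b.range_incl }
  obtain ⟨z, hz⟩ := c₀.exists_isRelFundamentalClass_of_smoothOrientation o
  exact ExtCollar.exists_isRelFundamentalClass_of_orientation (R := R) (m + 1)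
    ((ExtCollar.orientation z hz).toCoeff R)

/-- **Lefschetz vanishing over a field**: for `B` compact smooth oriented of dimension `m + 2`
(boundary presented by `b`), a field `F`, and `p + q = m + 2`, if `Hₚ(B; F) = 0` then
`H_q(B, ∂B; F) = 0` (Hatcher 2002, Thm. 3.43 with `A = ∅`: `a ↦ a ⌢ [B, ∂B]`,
`Hᵖ(B; F) → H_q(B, ∂B; F)` is onto, tree `bijective_relCapProduct_of_isRelFundamentalClass_holds`;
Thm. 3.2 / p. 198: `Hᵖ(B; F) ↪ Hom_F(Hₚ(B; F), F) = 0`, tree `kroneckerPairing_injective_of_field`).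
[cite: HatcherAT2002, §3.3 Thm. 3.43 (A = ∅) and §3.1 Thm. 3.2, p. 198] -/
theorem BoundaryData.isZero_relativeSingularHomology_of_isZero_singularHomology (F : Type) [Field F]
    (b : BoundaryData (𝓡∂ (m + 1 + 1)) B (𝓡 (m + 1))) (o : SmoothOrientation (𝓡∂ (m + 1 + 1)) B)
    {p q : ℕ} (hpq : p + q = m + 1 + 1) (hp : IsZero (singularHomology F F B p)) :
    IsZero (relativeSingularHomology F F B ((𝓡∂ (m + 1 + 1)).boundary B) q) := by
  obtain ⟨z, hz⟩ := b.exists_isRelFundamentalClass_of_smoothOrientation F o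
  have hbij := bijective_relCapProduct_of_isRelFundamentalClass_holds (R := F) (m + 1) B z hz hpq
  -- `Hᵖ(B; F) ↪ Hₚ(B; F)^* = 0`, hence the target of the duality surjection is trivial
  haveI : Subsingleton (singularHomology F F B p) := ModuleCat.subsingleton_of_isZero hp
  haveI : Subsingleton (singularCohomology F F B p) :=
    ⟨fun a c => kroneckerPairing_injective_of_field F B p
      (LinearMap.ext fun x => by rw [Subsingleton.elim x 0, map_zero, map_zero])⟩
  haveI : Subsingleton (relativeSingularHomology F F B ((𝓡∂ (m + 1 + 1)).boundary B) q) :=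
    ⟨fun x y => by
      obtain ⟨a, rfl⟩ := hbij.2 x
      obtain ⟨c, rfl⟩ := hbij.2 y
      rw [Subsingleton.elim a c]⟩
  exact ModuleCat.isZero_of_subsingleton _

/-- **`dim_F Hₖ(∂B; F) = dim_F Hₖ(B; F)` when `Hₚ(B; F) = Hₚ'(B; F) = 0`, `p + (k + 1) = dim B = p' + k`**,
for `B` compact smooth oriented of dimension `m + 2` with boundary presented by `b` (so
`b.carrier ≃ₜ ∂B` by `b.incl`): Lefschetz vanishing gives `Hₖ₊₁(B, ∂B; F) = 0 = Hₖ(B, ∂B; F)`, so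
`i_* : Hₖ(∂B; F) ≅ Hₖ(B; F)` by the exact sequence of the pair (Hatcher 2002, Thm. 3.43 and
Thm. 2.13 ff.). [cite: HatcherAT2002, §3.3 Thm. 3.43 and §2.1 Thm. 2.13 ff.] -/
theorem BoundaryData.finrank_singularHomology_carrier_eq (F : Type) [Field F]
    (b : BoundaryData (𝓡∂ (m + 1 + 1)) B (𝓡 (m + 1))) (o : SmoothOrientation (𝓡∂ (m + 1 + 1)) B)
    {k p p' : ℕ} (hp : p + (k + 1) = m + 1 + 1) (hp' : p' + k = m + 1 + 1)
    (h : IsZero (singularHomology F F B p)) (h' : IsZero (singularHomology F F B p')) :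
    Module.finrank F (singularHomology F F b.carrier k) = Module.finrank F (singularHomology F F B k) := by
  haveI := isIso_singularHomologyMap_subtypeVal_of_isZero F ((𝓡∂ (m + 1 + 1)).boundary B) k
    (b.isZero_relativeSingularHomology_of_isZero_singularHomology F o hp h)
    (b.isZero_relativeSingularHomology_of_isZero_singularHomology F o hp' h')
  -- the abstract boundary is homeomorphic to `∂B` over `B`
  let η : b.carrier ≃ₜ ↥((𝓡∂ (m + 1 + 1)).boundary B) :=
    b.isSmoothEmbedding.isEmbedding.toHomeomorph.trans (Homeomorph.setCongr b.range_incl)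
  exact ((singularHomology.mapIso F F η k).toLinearEquiv.trans
    (asIso (singularHomology.map F F
      (⟨Subtype.val, continuous_subtype_val⟩ : C(↥((𝓡∂ (m + 1 + 1)).boundary B), B)) k)).toLinearEquiv).finrank_eq

end General

/-! ### The case of fact E: rational 1-handlebodies of dimension 4 -/

/-- **`b₁(∂B; ℚ) = b₁(B; ℚ)` for a compact oriented smooth 4-manifold `B` with
`H₂(B; ℚ) = H₃(B; ℚ) = 0`** (e.g. a 4-dimensional 1-handlebody), boundary presented by the boundary
datum `b` (`b.carrier ≃ₜ ∂B`): by Lefschetz duality over `ℚ` (Hatcher 2002, Thm. 3.43 with the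
field universal coefficient theorem, Thm. 3.2 / p. 198) `H₂(B, ∂B; ℚ) ≅ H²(B; ℚ) ≅ H₂(B; ℚ)^* = 0`
and `H₁(B, ∂B; ℚ) ≅ H³(B; ℚ) ≅ H₃(B; ℚ)^* = 0`, so the exact sequence of the pair
`H₂(B, ∂B) → H₁(∂B) → H₁(B) → H₁(B, ∂B)` (Thm. 2.13 ff.) makes `H₁(∂B; ℚ) ≅ H₁(B; ℚ)`.
Sub-lemma (E-c) of `length_eq_bettiNumber_of_isLefschetzHandlebodyOver`; the hypothesis
`[Nonempty b.carrier]` is that consumer's and is not used. Specialisation `m = 2`, `k = 1`,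
`p = 2`, `p' = 3` of `BoundaryData.finrank_singularHomology_carrier_eq`.
[cite: HatcherAT2002, §3.3 Thm. 3.43, §3.1 Thm. 3.2 (p. 198), §2.1 Thm. 2.13 ff.] -/
theorem finrank_singularHomology_one_boundaryData_eq {B : Type} [TopologicalSpace B] [T2Space B] [SecondCountableTopology B]
    [CompactSpace B] [ChartedSpace (EuclideanHalfSpace 4) B] [IsManifold (𝓡∂ 4) ∞ B] (o : SmoothOrientation (𝓡∂ 4) B)
    (b : BoundaryData (𝓡∂ 4) B (𝓡 3)) [Nonempty b.carrier]
    (h₂ : IsZero (singularHomology ℚ ℚ B 2)) (h₃ : IsZero (singularHomology ℚ ℚ B 3)) :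
    Module.finrank ℚ (singularHomology ℚ ℚ b.carrier 1) = Module.finrank ℚ (singularHomology ℚ ℚ B 1) :=
  b.finrank_singularHomology_carrier_eq (m := 2) ℚ o (k := 1) (p := 2) (p' := 3) rfl rfl h₂ h₃

end Literature.Topology.FourManifolds

end
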